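import Literature.Computability.Complexity.Approximation
import Literature.Computability.Complexity.PromiseProofs
import HarnessLib

/-!
# Håstad's 7/8 + ε theorem: the complexity-theoretic shell (from gap-E3SAT hardness and gap-boosting machines)

The statement `hastad_seven_eighths` (`Approximation.lean`; Håstad 2001, Thm 6.5) is about polynomial-time
reductions (`FP`, Turing machines).  Its proof has two parts of a different nature: the NP-hardness of
SOME gap version of E3-SAT (the PCP theorem, `gapE3SAT ε₀` for an `ε₀ < 1/8`; in the tree the target of
`GapAssembly.lean`) and, for every `δ > 0`, a polynomial-time map from E3-CNFs to E3-CNFs taking satisfiable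
formulas to satisfiable ones and formulas of value `≤ 7/8 + ε₀` to formulas of value `≤ 7/8 + δ` — Håstad's
construction proper (parallel repetition + the 3-query long-code test), whose COMBINATORIAL correctness is the
content of `Hastad3SatAssembly.lean` / `Hastad3SatDart.lean` (`hastadCNF`: exact width 3, completeness,
value `≤ 7/8 + 2/k`).  This file isolates the remaining, machine-level, obligation:

* `HastadMachine ε₀ δ` — a string function `g ∈ FP` mapping the code of every E3-CNF `φ` to the code of an
  E3-CNF `ψ` with `φ` satisfiable `⇒ ψ` satisfiable and `val(φ) ≤ 7/8 + ε₀ ⇒ val(ψ) ≤ 7/8 + δ`;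
* `gapE3SAT_isNPHard_of_hastadMachine` — such a machine transports NP-hardness from `gapE3SAT ε₀` to
  `gapE3SAT δ` (composition in `FP`, `comp_mem_FP`);
* `hastad_seven_eighths_of_machines` — **`hastad_seven_eighths` follows from the NP-hardness of one
  `gapE3SAT ε₀` and Håstad machines for all rational `δ > 0`.**

Nothing here is specific to Håstad's construction; it records exactly what separates the tree's
combinatorial theorem from `hastad_seven_eighths_holds`.

## References

* J. Håstad, *Some optimal inapproximability results*, J. ACM 48 (2001) 798–859, Thm 6.5 and §2
  (Def. 2.16–2.17: NP-hard gap problems via polynomial-time reductions) [Hastad2001].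
* O. Goldreich, *On promise problems*, 2006, Def. 1.4 (reductions among promise problems) [Goldreich2006].
-/

namespace Literature.Computability.Complexity

open _root_.Computability

/-- A **Håstad machine** from gap `ε₀` to gap `δ`: a polynomial-time string function mapping the code of
every E3-CNF to the code of an E3-CNF, satisfiable to satisfiable and value `≤ 7/8 + ε₀` to value
`≤ 7/8 + δ`. [cite: Hastad2001, Thm 6.5 (the reduction behind it)] -/
structure HastadMachine (ε₀ δ : ℚ) where
  /-- the string function -/
  g : List Bool → List Bool
  /-- it is polynomial-time -/
  g_mem : g ∈ FP
  /-- its behaviour on codes of E3-CNFs -/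
  spec : ∀ φ : CNF ℕ, φ.IsExactWidth 3 → ∃ ψ : CNF ℕ,
    g (encodingCNF.encode φ) = encodingCNF.encode ψ ∧ ψ.IsExactWidth 3 ∧
      (φ.Satisfiable → ψ.Satisfiable) ∧ (φ.maxSatFraction ≤ 7 / 8 + ε₀ → ψ.maxSatFraction ≤ 7 / 8 + δ)

/-- **A Håstad machine transports NP-hardness of gap-E3SAT** from gap `ε₀` to gap `δ`.
[cite: Hastad2001, §2 (Def. 2.17) and Thm 6.5] -/
theorem gapE3SAT_isNPHard_of_hastadMachine {ε₀ δ : ℚ} (h₀ : (gapE3SAT ε₀).IsNPHard)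
    (M : HastadMachine ε₀ δ) : (gapE3SAT δ).IsNPHard := by
  intro L hL
  obtain ⟨f, hf, hyes, hno⟩ := h₀ L hL
  refine ⟨M.g ∘ f, comp_mem_FP M.g_mem hf, fun x hx => ?_, fun x hx => ?_⟩
  · have hfx := hyes hx
    rw [gapE3SAT_yes] at hfx
    obtain ⟨φ, ⟨hE3, hsat⟩, hφ⟩ := hfx
    obtain ⟨ψ, hg, hE3', hyes', -⟩ := M.spec φ hE3
    show M.g (f x) ∈ (gapE3SAT δ).yes
    rw [← hφ, hg, gapE3SAT_yes]
    exact ⟨ψ, ⟨hE3', hyes' hsat⟩, rfl⟩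
  · have hfx := hno hx
    rw [gapE3SAT_no] at hfx
    obtain ⟨φ, ⟨hE3, hval⟩, hφ⟩ := hfx
    obtain ⟨ψ, hg, hE3', -, hno'⟩ := M.spec φ hE3
    show M.g (f x) ∈ (gapE3SAT δ).no
    rw [← hφ, hg, gapE3SAT_no]
    exact ⟨ψ, ⟨hE3', hno' hval⟩, rfl⟩

/-- **Håstad's theorem from the PCP theorem in gap form and Håstad machines**: if `gapE3SAT ε₀` is NP-hard
for one `ε₀` and for every rational `δ > 0` there is a Håstad machine from `ε₀` to `δ`, then
`hastad_seven_eighths` holds. [cite: Hastad2001, Thm 6.5] -/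
theorem hastad_seven_eighths_of_machines {ε₀ : ℚ} (h₀ : (gapE3SAT ε₀).IsNPHard)
    (M : ∀ δ : ℚ, 0 < δ → HastadMachine ε₀ δ) : hastad_seven_eighths :=
  fun δ hδ => gapE3SAT_isNPHard_of_hastadMachine h₀ (M δ hδ)

/-- Conversely a Håstad machine is only needed up to the target gap: hardness of `gapE3SAT δ` gives
hardness of `gapE3SAT δ'` for `δ ≤ δ'` (the identity is such a machine). [cite: Hastad2001, §2 (Def. 2.17)] -/
theorem gapE3SAT_isNPHard_mono {δ δ' : ℚ} (h : (gapE3SAT δ).IsNPHard) (hle : δ ≤ δ') :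
    (gapE3SAT δ').IsNPHard :=
  gapE3SAT_isNPHard_of_hastadMachine h
    { g := id
      g_mem := PolyTimeComputable.id _
      spec := fun φ hE3 => ⟨φ, rfl, hE3, id, fun hv => hv.trans (by linarith)⟩ }

end Literature.Computability.Complexity
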